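import Literature.NumberTheory.GaloisRepresentations.InertiaCohomologyFinite
import Literature.NumberTheory.EllipticCurves.GreenbergSelmer
import Literature.NumberTheory.EllipticCurves.SelmerUnramified
import Literature.NumberTheory.EllipticCurves.GaloisActionProofs
import Literature.NumberTheory.EllipticCurves.SelmerInftyTorsionFiniteProofs
import Literature.NumberTheory.EllipticCurves.ZpExtensionUnramifiedProofs
import Literature.NumberTheory.EllipticCurves.PeriodIndexCorestrictionLocal
import Literature.NumberTheory.GaloisRepresentations.DecompositionGroupOfCompletion
import HarnessLib

/-!
# `{x ∈ H¹(I_w(K_∞), E[p^∞]) : p·x = 0}` is finite at a place `w ∤ p` of a `ℤ_p`-extension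
# (the `p`-torsion of Greenberg–Vatsal's local factor `𝓗_v(K_∞)`, one place at a time)

HONEST FRAMING (cell `b2b-bsdres`, run/shared/lean/b2b/bsd-rank1-residual/, verbatim in every
file): the goal of the cell is to DELETE the COMBINATION-SHAPED residual classes of the
Birch–Swinnerton-Dyer formula for ALL analytic-rank `≤ 1` elliptic curves over `ℚ` — "full BSD
formula for every rank `≤ 1` curve in class `C`" assembled STRICTLY from published theorems — so
that the rank-`≤ 1` remainder becomes exactly the CONSTRUCTION-SHAPED classes, which are TYPED
(missing-input `Prop`s), NOT attempted. This is not "finishing BSD". Team n1011 (N10/N11; row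
T-GV23-PA = the located gap P-α of the A240 derivation): research routes on CONSTRUCTION-SHAPED
classes; prove what is provable now; no claim beyond stated classes; census output = EVIDENCE,
never a Literature fact; RESIDUAL-MAP marks UNCHANGED; nothing is booked by this file. TOOL
THEOREMS ONLY: no definition, no named fact, nothing cited enters as a hypothesis.

## What

For a number field `K`, an elliptic curve `E/K` (`W.IsElliptic`), a prime `p`, ANY `ℤ_p`-extension
`κ : Γ_K →ₜ* ℤ_p` (`H = ker κ = Gal(K̄/K_∞)`) and a finite place `v ∤ p` of `K`, the set of
`p`-torsion classes of `H¹(inertiaIn H v, E[p^∞])` — the target of Greenberg–Vatsal's unramified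
local condition at the chosen place of `K_∞` above `v` (`GreenbergVatsal2000.unramifiedKer`, GV
2000 §2 p. 17: "`G_{(ℚ_∞)_η}/I_η` has profinite degree prime to `p`. So the last condition is
equivalent to `[σ|_{I_η}] = 0`") — is FINITE:

* `resH1Hom_injective_of_surjective` (§1, generic): inflation along a continuous SURJECTION
  `φ : G' ↠ G` through which the action of `G'` factors is injective on `H¹` (cocycle level).
* `finite_discreteH1_inertia_geomTorsion` (§2): `H¹(I_v, E[p])` is finite for the GLOBAL inertia
  group `GreenbergSelmer.inertia v = res (absInertia K_v) ≤ Γ_K`: inside the proof, `E[p]` with its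
  `Γ_{K_v}`-action through `absGaloisRestrict K K_v` is a `ContinuousRep` whose `TopRep` on
  `absInertia K_v` IS the tree's `discreteTopRep` (definitionally), so the tree's
  `natCard_continuousCohomology_one_absInertia_le` (Milne ADT I.2.9 / Serre CG II.5.5: `#H¹(I_F, B)
  ≤ #B` for `#B` prime to the residue characteristic; `#E[p] = p²`, `ringChar 𝓀[K_v] ≠ p` by
  `ringChar_residueField_adicCompletion_ne`) gives `H¹(I_{K_v}, E[p])` finite, and §1 along
  `absInertia K_v ↠ inertia v` transports it. No local-field instance or definition is declared.
* `inertia_le_kerSubgroup'` (§3): `inertia v ≤ ker κ` for EVERY `κ` and `v ∤ p` — the tree's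
  theorem `ZpExtension.inertia_le_kerSubgroup_holds` (Washington Prop. 13.2, proved in
  `ZpExtensionUnramifiedProofs` without class field theory) moved from the prime
  `adicCompletionPrime K v` to GreenbergSelmer's `inertia v` (`inertia_adicCompletionPrime_eq_map_absInertia`).
* **`finite_setOf_nsmul_eq_zero_discreteH1_inertiaIn`** (§4): `{x : H¹(inertiaIn H v, E[p^∞]) |
  p • x = 0}` is finite — transport `inertiaIn H v ≃ H ⊓ I_v`
  (`exists_injective_discreteH1_inertiaIn_to_inf`: two `resH1Hom`s composing to the identity),
  `H ⊓ I_v = I_v` as a pair of restrictions with a one-sided inverse, the Kummer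
  surjection `H¹(·, E[p]) ↠ H¹(·, E[p^∞])[p]` at any subgroup of `Γ_K`
  (`WeierstrassCurve.exists_torsionToPrimaryH1Sub_eq`), and §2.

This is the local half of "`𝓗_ℓ(ℚ_∞)` is `Λ`-cotorsion for `ℓ ≠ p`" (GV 2000 p. 20) in the only
currency the cell needs (finiteness of the `p`-torsion); the global half (finitely many places of
`K_∞` above `v`) is the sibling file `UnramifiedConditionFiniteOrbit`. Not here: the `Λ`-module
structure of `𝓗_ℓ`, its corank `s_ℓ d_ℓ` or characteristic ideal (GV Prop. (2.4)).

References: R. Greenberg, V. Vatsal, Invent. Math. 142 (2000) §2 pp. 16–17, 20; J. Milne,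
*Arithmetic Duality Theorems*, I Lemma 2.9; J.-P. Serre, *Cohomologie galoisienne*, II §5.5;
L. Washington, *Introduction to Cyclotomic Fields*, Prop. 13.2.
-/

noncomputable section

open scoped Classical
open NumberField IsDedekindDomain Field CategoryTheory
open Literature.NumberTheory.GaloisRepresentations Literature.NumberTheory.EllipticCurves
  Literature.NumberTheory.EllipticCurves.GreenbergSelmer

universe u

namespace Summit.BirchSwinnertonDyer.Rank1Residual.Iwasawa

/-! ## §1. Inflation along a surjection is injective on `H¹` -/

section Inflation

variable {G : Type u} [Group G] [TopologicalSpace G] [IsTopologicalGroup G]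
  {G' : Type u} [Group G'] [TopologicalSpace G'] [IsTopologicalGroup G']
  {M : Type u} [AddCommGroup M] [DistribMulAction G M] [DistribMulAction G' M]
  [TopologicalSpace M] [DiscreteTopology M]

/-- **Inflation along a continuous surjection is injective on `H¹`.** If `φ : G' ↠ G` is a
continuous surjective homomorphism and `G'` acts on the discrete module `M` through `φ`
(`x • m = φ x • m`), then `res_{(φ, id)} : H¹(G, M) → H¹(G', M)` is injective: a cocycle `f` on
`G` with `f (φ x) = φ x • m - m` for all `x` is the coboundary of `m` on all of `G = φ(G')`.
Serre, *Galois Cohomology*, I §2.6 (inflation); Neukirch–Schmidt–Wingberg (1.6.6). [folklore] -/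
theorem resH1Hom_injective_of_surjective (φ : G' →ₜ* G) (hφ : Function.Surjective φ)
    (h : ∀ (x : G') (m : M), φ x • m = x • m) :
    Function.Injective (resH1Hom φ (AddMonoidHom.id M) fun x m ↦ h x m) := by
  refine (injective_iff_map_eq_zero _).2 fun c hc ↦ ?_
  obtain ⟨f, rfl⟩ := oneCocycleClass_surjective _ c
  rw [resH1Hom_oneCocycleClass, oneCocycleClass_eq_zero_iff] at hc
  obtain ⟨m, hm⟩ := hc
  rw [oneCocycleClass_eq_zero_iff]
  refine ⟨m, fun g ↦ ?_⟩
  obtain ⟨x, rfl⟩ := hφ g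
  have hx := hm x
  rw [pullback_resHomOfEquivariant_apply, AddMonoidHom.id_apply] at hx
  rw [hx]
  change x • m - m = φ x • m - m
  rw [h]

end Inflation

/-! ## §2. `H¹(I_v, E[p])` is finite for `v ∤ p` -/

section Local

variable {K : Type u} [Field K] [NumberField K] (W : WeierstrassCurve K) (p : ℕ)
  (v : HeightOneSpectrum (𝓞 K))

/-- **`H¹(I_v, E[p])` is finite for `v ∤ p`**, for GreenbergSelmer's inertia group
`inertia v = res (absInertia K_v) ≤ Γ_K` at the chosen place above `v`. Inside the proof: `E[p]`
with the `Γ_{K_v}`-action through `absGaloisRestrict K K_v` as a `ContinuousRep` over `ℤ` (jointly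
continuous: `E[p]` is discrete with continuous orbit maps, `continuousSMul_geomTorsion`), whose
`TopRep` restricted to `absInertia K_v` IS the tree's `discreteTopRep` (definitionally); `#E[p] = p²`
(`card_torsionPoints_eq_sq_holds`) is prime to `ringChar 𝓀[K_v] ≠ p`
(`ringChar_residueField_adicCompletion_ne`), so `H¹(I_{K_v}, E[p])` is finite by the tree's
`natCard_continuousCohomology_one_absInertia_le` (Milne ADT I.2.9); and inflation along the
surjection `absInertia K_v ↠ inertia v` is injective (§1). [cite: MilneADT2006, I §2 Lemma 2.9] -/
theorem finite_discreteH1_inertia_geomTorsion [W.IsElliptic] [Fact p.Prime]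
    (hpv : (p : 𝓞 K) ∉ v.asIdeal) :
    Finite (discreteH1 (inertia (K := K) v) (WeierstrassCurve.geomTorsion W (p : ℤ))) := by
  have hp : (p : ℕ).Prime := Fact.out
  -- the local action (through the chosen embedding), as a local instance of this proof only
  letI : DistribMulAction (absoluteGaloisGroup (v.adicCompletion K))
      (WeierstrassCurve.geomTorsion W (p : ℤ)) :=
    DistribMulAction.compHom _ (absGaloisRestrict K (v.adicCompletion K)).toMonoidHom
  haveI : ContinuousSMul (absoluteGaloisGroup K) (WeierstrassCurve.geomTorsion W (p : ℤ)) :=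
    WeierstrassCurve.continuousSMul_geomTorsion W (WeierstrassCurve.isOpen_stabilizer_point_holds W) _
  -- `E[p]` as a `ContinuousRep` of `Γ_{K_v}` over `ℤ`
  let ρ : ContinuousRep (absoluteGaloisGroup (v.adicCompletion K)) ℤ
      (WeierstrassCurve.geomTorsion W (p : ℤ)) :=
    { toRepresentation :=
        (discreteContRep (absoluteGaloisGroup (v.adicCompletion K))
          (WeierstrassCurve.geomTorsion W (p : ℤ))).toRepresentation
      continuous_smul := by
        refine continuous_prod_of_discrete_right.mpr fun b ↦ ?_
        change Continuous fun σ : absoluteGaloisGroup (v.adicCompletion K) ↦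
          absGaloisRestrict K (v.adicCompletion K) σ • b
        exact (continuous_id.smul continuous_const :
          Continuous fun τ : absoluteGaloisGroup K ↦ τ • b).comp
            (absGaloisRestrict K (v.adicCompletion K)).continuous_toFun }
  -- the definitional bridge between the two formalisms
  have hbridge : (ρ.restrict (Literature.NumberTheory.GaloisRepresentations.subgroupIncl
      (absInertia (v.adicCompletion K)))).toTopRep =
      discreteTopRep (absInertia (v.adicCompletion K)) (WeierstrassCurve.geomTorsion W (p : ℤ)) :=
    rfl
  -- `H¹(I_{K_v}, E[p])` is finite
  haveI : Finite (WeierstrassCurve.geomTorsion W (p : ℤ)) :=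
    WeierstrassCurve.finite_torsionPoints_holds W (AlgebraicClosure K) (by exact_mod_cast hp.ne_zero)
  have hcard : Nat.card (WeierstrassCurve.geomTorsion W (p : ℤ)) = p ^ 2 :=
    WeierstrassCurve.card_torsionPoints_eq_sq_holds W (AlgebraicClosure K) (by
      haveI : CharZero (AlgebraicClosure K) :=
        charZero_of_injective_algebraMap (algebraMap K (AlgebraicClosure K)).injective
      exact_mod_cast hp.ne_zero)
  have hℓ := ringChar_residueField_prime (F := v.adicCompletion K)
  have hne := v.ringChar_residueField_adicCompletion_ne hpv
  have hfin := (natCard_continuousCohomology_one_absInertia_le (v.adicCompletion K) ρ (by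
      rw [hcard]
      exact ((Nat.coprime_primes hp hℓ).2 (Ne.symm hne)).pow_left 2)).1
  rw [hbridge] at hfin
  -- inflation along `absInertia K_v ↠ inertia v`
  let θ : absInertia (v.adicCompletion K) →ₜ* inertia (K := K) v :=
    { toFun := fun x ↦ ⟨absGaloisRestrict K (v.adicCompletion K) x, Subgroup.mem_map_of_mem _ x.2⟩
      map_one' := Subtype.ext (by simp)
      map_mul' := fun x y ↦ Subtype.ext (by simp)
      continuous_toFun :=
        ((absGaloisRestrict K (v.adicCompletion K)).continuous_toFun.comp
          continuous_subtype_val).subtype_mk _ }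
  have hθ : Function.Surjective θ := by
    rintro ⟨y, hy⟩
    obtain ⟨x, hx, rfl⟩ := Subgroup.mem_map.1 hy
    exact ⟨⟨x, hx⟩, rfl⟩
  exact Finite.of_injective _ (resH1Hom_injective_of_surjective θ hθ fun _ _ ↦ rfl)

end Local

/-! ## §3. `inertia v ≤ ker κ` for every `ℤ_p`-extension and `v ∤ p` -/

section Unramified

variable {K : Type u} [Field K] [NumberField K] {p : ℕ} [Fact p.Prime] (κ : ZpExtension K p)
  (v : HeightOneSpectrum (𝓞 K))

/-- **Every `ℤ_p`-extension is unramified at `v ∤ p`**, in GreenbergSelmer's vocabulary: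
`inertia v ≤ ker κ`. This is the tree THEOREM `ZpExtension.inertia_le_kerSubgroup_holds`
(Washington Prop. 13.2, proved in `ZpExtensionUnramifiedProofs` along Lang's local argument) at
the prime `𝔓₀ = adicCompletionPrime K v` cut out by the chosen embedding, whose inertia group IS
`inertia v` (`inertia_adicCompletionPrime_eq_map_absInertia`, Neukirch II (9.6)).
[cite: Washington1997, Prop. 13.2] -/
theorem inertia_le_kerSubgroup' (hpv : (p : 𝓞 K) ∉ v.asIdeal) :
    inertia (K := K) v ≤ κ.kerSubgroup := by
  intro x hx
  have hx' : x ∈ (adicCompletionPrime K v).inertia (absoluteGaloisGroup K) := by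
    rw [inertia_adicCompletionPrime_eq_map_absInertia]; exact hx
  exact ZpExtension.inertia_le_kerSubgroup_holds K p κ hpv (adicCompletionPrime_mem_primesAbove K v) hx'

end Unramified

/-! ## §4. `{x ∈ H¹(inertiaIn H v, E[p^∞]) : p·x = 0}` is finite -/

section Tower

variable {K : Type u} [Field K] [NumberField K] (W : WeierstrassCurve K) [W.IsElliptic]
  {p : ℕ} [Fact p.Prime] (κ : ZpExtension K p) (v : HeightOneSpectrum (𝓞 K))

/-- `res` along `H ⊓ I_v → inertiaIn H v` (the same group seen inside `D_v`) is injective on `H¹`: the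
restriction along the inverse isomorphism is a left inverse (`resH1Hom_comp`, `resH1Hom_id`).
Stated as an existence of an injective additive map (no definition introduced). [folklore] -/
theorem exists_injective_discreteH1_inertiaIn_to_inf (H : Subgroup (absoluteGaloisGroup K))
    (M : Type u) [AddCommGroup M] [DistribMulAction (absoluteGaloisGroup K) M] [TopologicalSpace M]
    [DiscreteTopology M] :
    ∃ r : discreteH1 (inertiaIn H v) M →+ discreteH1 ↥(H ⊓ inertia (K := K) v) M,
      Function.Injective r := by
  let e : ↥(H ⊓ inertia (K := K) v) →ₜ* inertiaIn H v :=
    { toFun := fun x ↦ ⟨⟨x.1, inertia_le_decomp v x.2.2⟩, (mem_inertiaIn_iff H v _).2 x.2⟩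
      map_one' := rfl
      map_mul' := fun _ _ ↦ rfl
      continuous_toFun := (continuous_subtype_val.subtype_mk _).subtype_mk _ }
  let e' : inertiaIn H v →ₜ* ↥(H ⊓ inertia (K := K) v) :=
    { toFun := fun x ↦ ⟨x.1.1, (mem_inertiaIn_iff H v _).1 x.2⟩
      map_one' := rfl
      map_mul' := fun _ _ ↦ rfl
      continuous_toFun := (continuous_subtype_val.comp continuous_subtype_val).subtype_mk _ }
  refine ⟨resH1Hom e (AddMonoidHom.id M) fun _ _ ↦ rfl, Function.LeftInverse.injective
    (g := resH1Hom e' (AddMonoidHom.id M) fun _ _ ↦ rfl) fun c ↦ ?_⟩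
  rw [← AddMonoidHom.comp_apply, resH1Hom_comp]
  have h := resH1Hom_congr (φ := e.comp e') (φ' := ContinuousMonoidHom.id _)
    (ψ := (AddMonoidHom.id M).comp (AddMonoidHom.id M)) (ψ' := AddMonoidHom.id M)
    (by ext; rfl) (by ext; rfl) (fun _ _ ↦ rfl) (fun _ _ ↦ rfl)
  rw [h, resH1Hom_id, AddMonoidHom.id_apply]

/-- **`{x ∈ H¹(inertiaIn H v, E[p^∞]) : p • x = 0}` is finite** for `H = ker κ`, ANY
`ℤ_p`-extension `κ` of the number field `K`, any elliptic `E/K` and any finite place `v ∤ p` — the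
`p`-torsion of Greenberg–Vatsal's local factor at the chosen place of `K_∞` above `v` (GV 2000 §2
p. 17; p. 20 "`𝓗_ℓ(ℚ_∞)` is `Λ`-cotorsion for `ℓ ≠ p`", in the currency of `p`-torsion). Chain:
`H¹(inertiaIn H v, A) ↪ H¹(H ⊓ I_v, A)` (transport), `H ⊓ I_v = I_v` (§3, as a restriction with a
one-sided inverse), Kummer `H¹(I_v, E[p]) ↠ H¹(I_v, E[p^∞])[p]`
(`WeierstrassCurve.exists_torsionToPrimaryH1Sub_eq`), and `H¹(I_v, E[p])` finite (§2).
[cite: GreenbergVatsal2000, §2 pp. 17, 20] [cite: MilneADT2006, I §2 Lemma 2.9] -/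
theorem finite_setOf_nsmul_eq_zero_discreteH1_inertiaIn (hpv : (p : 𝓞 K) ∉ v.asIdeal) :
    Set.Finite {x : discreteH1 (inertiaIn κ.kerSubgroup v) (W.geomPrimaryTorsion p) | p • x = 0} := by
  set H := κ.kerSubgroup with hH
  -- the three comparison maps
  obtain ⟨r₁, hr₁⟩ :=
    exists_injective_discreteH1_inertiaIn_to_inf (K := K) v H (W.geomPrimaryTorsion p)
  have hle : inertia (K := K) v ≤ H ⊓ inertia (K := K) v :=
    le_inf (inertia_le_kerSubgroup' κ v hpv) le_rfl
  let r₂ : Literature.NumberTheory.EllipticCurves.subgroupH1 (H ⊓ inertia (K := K) v)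
      (WeierstrassCurve.geomTorsion W (p : ℤ)) →+
      Literature.NumberTheory.EllipticCurves.subgroupH1 (inertia (K := K) v)
        (WeierstrassCurve.geomTorsion W (p : ℤ)) :=
    resOfLe (WeierstrassCurve.geomTorsion W (p : ℤ)) hle
  have hr₂ : Function.Injective r₂ := by
    refine Function.LeftInverse.injective
      (g := resOfLe (WeierstrassCurve.geomTorsion W (p : ℤ)) (inf_le_right : H ⊓ inertia (K := K) v ≤ _))
      fun c ↦ ?_
    rw [← AddMonoidHom.comp_apply, resOfLe_comp_holds, resOfLe_refl_holds, AddMonoidHom.id_apply]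
  -- the finite source
  haveI := finite_discreteH1_inertia_geomTorsion W p v hpv
  haveI : Finite (Literature.NumberTheory.EllipticCurves.subgroupH1 (H ⊓ inertia (K := K) v)
      (WeierstrassCurve.geomTorsion W (p : ℤ))) := Finite.of_injective _ hr₂
  -- the `p`-torsion of `H¹(H ⊓ I_v, E[p^∞])` is the image of `H¹(H ⊓ I_v, E[p])`
  have hT : Set.Finite {y : W.subgroupH1 p (H ⊓ inertia (K := K) v) | p • y = 0} := by
    refine ((Set.finite_univ (α := Literature.NumberTheory.EllipticCurves.subgroupH1
      (H ⊓ inertia (K := K) v) (WeierstrassCurve.geomTorsion W (p : ℤ)))).image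
      (W.torsionToPrimaryH1Sub p (H ⊓ inertia (K := K) v))).subset fun y hy ↦ ?_
    obtain ⟨z, hz⟩ := W.exists_torsionToPrimaryH1Sub_eq p W.zsmul_geomPoints_surjective_holds hy
    exact ⟨z, Set.mem_univ _, hz⟩
  -- pull back along the injection `r₁`
  refine (hT.preimage hr₁.injOn).subset fun x hx ↦ ?_
  show p • r₁ x = 0
  rw [← map_nsmul, (hx : p • x = 0), map_zero]

end Tower

end Summit.BirchSwinnertonDyer.Rank1Residual.Iwasawa

end
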